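import Summits.CriticalPhenomena.PercolationContinuityZ3.Theorems.SahiMasterFamilyE3FCovariance
import Summits.CriticalPhenomena.PercolationContinuityZ3.Theorems.SahiMasterFamilyFibreCubic
import HarnessLib

/-!
# Harris' inequality on the fibres of a disjoint set of coordinates

Unit `prim-master-conj` (crux anchor stmt-CriticalPhenomena-4575, helper work), gen 38; memo
`run/shared/lean/prim/prim-l12/prim-master-conj/POINTWISE.md` §39.

Write `μ⟦X⟧ = E(1_X)` under the product weight `μ_p` on configurations `ω ⊆ ι`.  For a finite coordinate set `T` and
`τ ⊆ T` the **fibre** (atom) `𝔞(T,τ) = {ω | ω ∩ T = τ}` is closed under `∩` and `∪`, so the restricted weight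
`μ_p·1_{𝔞(T,τ)}` is again log-supermodular and the FKG inequality holds conditionally on the fibre
(`condFKG_ex_ind_of_closed`, the general form of `condHarris_ex_ind_cylinder`).  Consequences:

* `fibreHarris_atom` — if `A` is increasing and determined by coordinates disjoint from `T`, and `W` is increasing,
  then `μ⟦A⟧·μ⟦W ∩ 𝔞(T,τ)⟧ ≤ μ⟦A ∩ W ∩ 𝔞(T,τ)⟧` (independence of `A` from the fibre + conditional FKG);
* **`fibreHarris_of_determinedBy`** — the same with the fibre replaced by ANY event `C` determined by `T`
  (not necessarily monotone): `μ⟦A⟧·μ⟦W ∩ C⟧ ≤ μ⟦A ∩ W ∩ C⟧`.  This is "Harris applied fibre by fibre": the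
  `T`-coordinates are frozen, `A` does not see them, and `W` is increasing on every fibre.
These are the "fine" Harris atoms of the lineage's type-space certificates (POINTWISE §34–39): `A = a_x` an
`S`-determined increasing event, `C` a Boolean combination of `T`-determined increasing events `b_v`, `W` arbitrary
increasing. [this work]
-/

noncomputable section

open scoped Classical

namespace Summit.CriticalPhenomena.PercolationContinuityZ3.Theorems

namespace FibrewiseHarris

open Finset Function
open Literature.Combinatorics.Sahi2008
open Literature.Probability.Percolation (DeterminedBy determinedBy_iff)
open Literature.Probability.Percolation.DecisionTree (ind ind_nonneg ind_of_mem ind_of_not_mem)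
open Literature.Probability.LatticeModels (prodBernoulli prodBernoulli_real_inter_of_determinedBy_disjoint)

variable {ι : Type} [Fintype ι]

local notation3 (prettyPrint := false) "μ⟦" q ", " X "⟧" => ex (bernoulliWeight q) (ind X)

/-! ### 1. Conditional FKG on an event closed under `∩` and `∪` -/

omit [Fintype ι] in
/-- Restricting a nonnegative log-supermodular weight to an event closed under `∩` and `∪` keeps it
log-supermodular. [cite: Blinovsky2013, Lemma (arXiv text p. 1)] -/
theorem logSupermodular_restrict_closed {μ : Set ι → ℝ} (hμ₀ : ∀ ω, 0 ≤ μ ω)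
    (hμ : ∀ a b, μ a * μ b ≤ μ (a ⊓ b) * μ (a ⊔ b)) {P : Set (Set ι)}
    (hinf : ∀ a b, a ∈ P → b ∈ P → a ∩ b ∈ P) (hsup : ∀ a b, a ∈ P → b ∈ P → a ∪ b ∈ P) (a b : Set ι) :
    (μ a * ind P a) * (μ b * ind P b) ≤ (μ (a ⊓ b) * ind P (a ⊓ b)) * (μ (a ⊔ b) * ind P (a ⊔ b)) := by
  have hR : 0 ≤ (μ (a ⊓ b) * ind P (a ⊓ b)) * (μ (a ⊔ b) * ind P (a ⊔ b)) :=
    mul_nonneg (mul_nonneg (hμ₀ _) (ind_nonneg P _)) (mul_nonneg (hμ₀ _) (ind_nonneg P _))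
  by_cases ha : a ∈ P
  · by_cases hb : b ∈ P
    · rw [ind_of_mem ha, ind_of_mem hb, ind_of_mem (show a ⊓ b ∈ P from hinf a b ha hb),
        ind_of_mem (show a ⊔ b ∈ P from hsup a b ha hb)]
      simpa using hμ a b
    · rw [ind_of_not_mem hb]; simpa using hR
  · rw [ind_of_not_mem ha]; simpa using hR

/-- **FKG conditionally on an event closed under `∩` and `∪`**: for increasing `A, B` and such an event `P`,
`E(1_{A∩P})E(1_{B∩P}) ≤ E(1_P)E(1_{A∩B∩P})` under a product weight (the weight `μ_p·1_P` is log-supermodular).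
[cite: Blinovsky2013, Lemma (arXiv text p. 1)] -/
theorem condFKG_ex_ind_of_closed (p : ι → unitInterval) {A B P : Set (Set ι)} (hA : IsUpperSet A)
    (hB : IsUpperSet B) (hinf : ∀ a b, a ∈ P → b ∈ P → a ∩ b ∈ P)
    (hsup : ∀ a b, a ∈ P → b ∈ P → a ∪ b ∈ P) :
    μ⟦p, A ∩ P⟧ * μ⟦p, B ∩ P⟧ ≤ μ⟦p, P⟧ * μ⟦p, A ∩ B ∩ P⟧ := by
  have hμ := isFKGMeasure_bernoulliWeight p
  set ν : Set ι → ℝ := fun ω => bernoulliWeight p ω * ind P ω with hν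
  have hν₀ : 0 ≤ ν := fun ω => mul_nonneg (hμ.nonneg ω) (ind_nonneg P ω)
  have hνlat : ∀ a b, ν a * ν b ≤ ν (a ⊓ b) * ν (a ⊔ b) := fun a b =>
    logSupermodular_restrict_closed (fun ω => hμ.nonneg ω) hμ.mul_le_mul hinf hsup a b
  have h := fkg (ind A) (ind B) ν hν₀ (fun ω => ind_nonneg A ω) (fun ω => ind_nonneg B ω)
    (monotone_ind_of_isUpperSet hA) (monotone_ind_of_isUpperSet hB) hνlat
  have e1 : ∀ C : Set (Set ι), (∑ ω, ν ω * ind C ω) = μ⟦p, C ∩ P⟧ := fun C => by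
    simp only [ex, hν]
    refine Finset.sum_congr rfl fun ω _ => ?_
    rw [Literature.Probability.Percolation.BHK2006.ind_inter]; ring
  have e0 : (∑ ω, ν ω) = μ⟦p, P⟧ := by simp only [ex, hν]
  have e2 : (∑ ω, ν ω * (ind A ω * ind B ω)) = μ⟦p, A ∩ B ∩ P⟧ := by
    rw [← e1 (A ∩ B)]
    refine Finset.sum_congr rfl fun ω _ => ?_
    rw [Literature.Probability.Percolation.BHK2006.ind_inter]
  rw [e1, e1, e0, e2] at h
  exact h

/-! ### 2. Fibres of a coordinate set -/

/-! The fibre (atom) of the coordinate set `T` through `τ` is written out as the event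
`{ω | ∀ i ∈ T, i ∈ ω ↔ i ∈ τ}` (configurations whose trace on `T` is `τ ∩ T`); the traces `τ ⊆ T` whose fibre lies in a
`T`-determined event `C` form `(Finset.powerset T).filter (fun τ => ↑τ ∈ C)`.  (No auxiliary definitions, so that the
file stays a pure proof file.) -/

omit [Fintype ι] in
/-- Fibres are closed under intersection. [folklore] -/
theorem inter_mem_atom {T τ : Finset ι} {a b : Set ι} (ha : a ∈ {ω : Set ι | ∀ i ∈ T, i ∈ ω ↔ i ∈ τ}) (hb : b ∈ {ω : Set ι | ∀ i ∈ T, i ∈ ω ↔ i ∈ τ}) :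
    a ∩ b ∈ {ω : Set ι | ∀ i ∈ T, i ∈ ω ↔ i ∈ τ} := fun i hi =>
  ⟨fun h => (ha i hi).1 h.1, fun h => ⟨(ha i hi).2 h, (hb i hi).2 h⟩⟩

omit [Fintype ι] in
/-- Fibres are closed under union. [folklore] -/
theorem union_mem_atom {T τ : Finset ι} {a b : Set ι} (ha : a ∈ {ω : Set ι | ∀ i ∈ T, i ∈ ω ↔ i ∈ τ}) (hb : b ∈ {ω : Set ι | ∀ i ∈ T, i ∈ ω ↔ i ∈ τ}) :
    a ∪ b ∈ {ω : Set ι | ∀ i ∈ T, i ∈ ω ↔ i ∈ τ} := fun i hi =>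
  ⟨fun h => h.elim (fun h' => (ha i hi).1 h') (fun h' => (hb i hi).1 h'), fun h => Or.inl ((ha i hi).2 h)⟩

omit [Fintype ι] in
/-- A fibre of `T` is determined by `T`. [folklore] -/
theorem determinedBy_atom (T τ : Finset ι) : DeterminedBy ({ω : Set ι | ∀ i ∈ T, i ∈ ω ↔ i ∈ τ}) (↑T : Set ι) := by
  rw [determinedBy_iff]
  intro ω ω' h
  have key : ∀ i ∈ T, (i ∈ ω ↔ i ∈ ω') := fun i hi => by
    constructor
    · intro hω; exact ((Set.ext_iff.1 h i).1 ⟨hω, hi⟩).1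
    · intro hω'; exact ((Set.ext_iff.1 h i).2 ⟨hω', hi⟩).1
  simp only [Set.mem_setOf_eq]
  exact ⟨fun H i hi => (key i hi).symm.trans (H i hi), fun H i hi => (key i hi).trans (H i hi)⟩

omit [Fintype ι] in
/-- The fibre through `ω` itself: `ω ∈ 𝔞(T, T ∩ ω)`. [folklore] -/
theorem mem_atom_filter (T : Finset ι) (ω : Set ι) : ω ∈ {ω' : Set ι | ∀ i ∈ T, i ∈ ω' ↔ i ∈ T.filter fun i => i ∈ ω} := fun i hi => by
  simp [Finset.mem_filter, hi]

omit [Fintype ι] in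
/-- Among the `τ ⊆ T`, the only fibre containing `ω` is the one through `T ∩ ω`. [folklore] -/
theorem eq_filter_of_mem_atom {T τ : Finset ι} (hτ : τ ⊆ T) {ω : Set ι} (hω : ω ∈ {ω : Set ι | ∀ i ∈ T, i ∈ ω ↔ i ∈ τ}) :
    τ = T.filter fun i => i ∈ ω := by
  ext i
  simp only [Finset.mem_filter]
  constructor
  · intro hiτ; exact ⟨hτ hiτ, (hω i (hτ hiτ)).2 hiτ⟩
  · rintro ⟨hiT, hiω⟩; exact (hω i hiT).1 hiω

omit [Fintype ι] in
/-- An event determined by `T` contains `ω` iff it contains the trace `T ∩ ω`. [folklore] -/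
theorem mem_iff_filter_mem {C : Set (Set ι)} {T : Finset ι} (hC : DeterminedBy C (↑T : Set ι)) (ω : Set ι) :
    ω ∈ C ↔ (↑(T.filter fun i => i ∈ ω) : Set ι) ∈ C := by
  rw [determinedBy_iff] at hC
  refine hC ω _ ?_
  ext i
  simp only [Set.mem_inter_iff, Finset.mem_coe, Finset.mem_filter]
  tauto

omit [Fintype ι] in
/-- Membership in the finite set of traces `τ ⊆ T` lying in `C`. [folklore] -/
theorem mem_atomsIn {C : Set (Set ι)} {T τ : Finset ι} :
    τ ∈ (Finset.powerset T).filter (fun τ : Finset ι => ((↑τ : Set ι) ∈ C)) ↔ τ ⊆ T ∧ (↑τ : Set ι) ∈ C := by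
  simp [Finset.mem_filter, Finset.mem_powerset]

omit [Fintype ι] in
/-- **Fibre decomposition of an event determined by `T`:** for every event `X`,
`1_{X ∩ C} = Σ_{τ ⊆ T, τ ∈ C} 1_{X ∩ 𝔞(T,τ)}` pointwise. [this work] -/
theorem ind_inter_eq_sum_atoms {C : Set (Set ι)} {T : Finset ι} (hC : DeterminedBy C (↑T : Set ι))
    (X : Set (Set ι)) (ω : Set ι) :
    ind (X ∩ C) ω = ∑ τ ∈ (Finset.powerset T).filter (fun τ : Finset ι => ((↑τ : Set ι) ∈ C)), ind (X ∩ {ω : Set ι | ∀ i ∈ T, i ∈ ω ↔ i ∈ τ}) ω := by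
  set τ₀ : Finset ι := T.filter fun i => i ∈ ω with hτ₀
  have hone : ∀ τ ∈ (Finset.powerset T).filter (fun τ : Finset ι => ((↑τ : Set ι) ∈ C)), τ ≠ τ₀ → ind (X ∩ {ω : Set ι | ∀ i ∈ T, i ∈ ω ↔ i ∈ τ}) ω = 0 := by
    intro τ hτ hne
    refine ind_of_not_mem fun h => hne ?_
    exact eq_filter_of_mem_atom (mem_atomsIn.1 hτ).1 h.2
  by_cases hωC : ω ∈ C
  · have hτ₀C : (↑τ₀ : Set ι) ∈ C := (mem_iff_filter_mem hC ω).1 hωC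
    have hmem : τ₀ ∈ (Finset.powerset T).filter (fun τ : Finset ι => ((↑τ : Set ι) ∈ C)) := mem_atomsIn.2 ⟨Finset.filter_subset _ _, hτ₀C⟩
    rw [Finset.sum_eq_single_of_mem τ₀ hmem fun τ hτ hne => hone τ hτ hne]
    by_cases hX : ω ∈ X
    · rw [ind_of_mem (Set.mem_inter hX hωC), ind_of_mem (Set.mem_inter hX (mem_atom_filter T ω))]
    · rw [ind_of_not_mem fun h => hX h.1, ind_of_not_mem fun h => hX h.1]
  · rw [ind_of_not_mem fun h => hωC h.2]
    symm
    refine Finset.sum_eq_zero fun τ hτ => ?_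
    by_cases hne : τ = τ₀
    · subst hne
      exact absurd ((mem_iff_filter_mem hC ω).2 (mem_atomsIn.1 hτ).2) hωC
    · exact hone τ hτ hne

/-- The fibre decomposition in expectation: `μ⟦X ∩ C⟧ = Σ_{τ ⊆ T, τ ∈ C} μ⟦X ∩ 𝔞(T,τ)⟧`. [this work] -/
theorem ex_ind_inter_eq_sum_atoms (p : ι → unitInterval) {C : Set (Set ι)} {T : Finset ι}
    (hC : DeterminedBy C (↑T : Set ι)) (X : Set (Set ι)) :
    μ⟦p, X ∩ C⟧ = ∑ τ ∈ (Finset.powerset T).filter (fun τ : Finset ι => ((↑τ : Set ι) ∈ C)), μ⟦p, X ∩ {ω : Set ι | ∀ i ∈ T, i ∈ ω ↔ i ∈ τ}⟧ := by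
  simp only [ex]
  rw [Finset.sum_comm]
  refine Finset.sum_congr rfl fun ω _ => ?_
  rw [ind_inter_eq_sum_atoms hC X ω, Finset.mul_sum]

/-! ### 3. Harris fibre by fibre -/

/-- `E(1_X) ≤ E(1_Y)` for `X ⊆ Y`. [folklore] -/
private theorem ex_ind_mono' (p : ι → unitInterval) {X Y : Set (Set ι)} (h : X ⊆ Y) : μ⟦p, X⟧ ≤ μ⟦p, Y⟧ := by
  refine ex_mono (fun ω => (isFKGMeasure_bernoulliWeight p).nonneg ω) fun ω => ?_
  by_cases hX : ω ∈ X
  · rw [ind_of_mem hX, ind_of_mem (h hX)]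
  · rw [ind_of_not_mem hX]; exact ind_nonneg Y ω

/-- **Harris on one fibre.**  If `A` is increasing and determined by `S`, `W` is increasing, and `T` is disjoint from
`S`, then for every fibre `𝔞 = 𝔞(T,τ)`: `μ⟦A⟧·μ⟦W ∩ 𝔞⟧ ≤ μ⟦A ∩ W ∩ 𝔞⟧`. [this work] -/
theorem fibreHarris_atom (p : ι → unitInterval) {A W : Set (Set ι)} (hA : IsUpperSet A) (hW : IsUpperSet W)
    {S T : Finset ι} (hST : Disjoint S T) (hAS : DeterminedBy A (↑S : Set ι)) (τ : Finset ι) :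
    μ⟦p, A⟧ * μ⟦p, W ∩ {ω : Set ι | ∀ i ∈ T, i ∈ ω ↔ i ∈ τ}⟧ ≤ μ⟦p, A ∩ W ∩ {ω : Set ι | ∀ i ∈ T, i ∈ ω ↔ i ∈ τ}⟧ := by
  set P := {ω : Set ι | ∀ i ∈ T, i ∈ ω ↔ i ∈ τ}
  have hcond := condFKG_ex_ind_of_closed p hA hW (P := P) (fun a b ha hb => inter_mem_atom ha hb)
    (fun a b ha hb => union_mem_atom ha hb)
  have hind : μ⟦p, A ∩ P⟧ = μ⟦p, A⟧ * μ⟦p, P⟧ := by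
    rw [ex_bernoulliWeight_ind, ex_bernoulliWeight_ind, ex_bernoulliWeight_ind]
    exact prodBernoulli_real_inter_of_determinedBy_disjoint p hST hAS (determinedBy_atom T τ)
      MeasurableSet.of_discrete MeasurableSet.of_discrete
  rw [hind] at hcond
  have hP0 : 0 ≤ μ⟦p, P⟧ := ex_nonneg (fun ω => (isFKGMeasure_bernoulliWeight p).nonneg ω) (ind_nonneg P)
  rcases hP0.eq_or_lt with hP | hP
  · have hWP : μ⟦p, W ∩ P⟧ = 0 :=
      le_antisymm (hP ▸ ex_ind_mono' p Set.inter_subset_right)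
        (ex_nonneg (fun ω => (isFKGMeasure_bernoulliWeight p).nonneg ω) (ind_nonneg _))
    rw [hWP, mul_zero]
    exact ex_nonneg (fun ω => (isFKGMeasure_bernoulliWeight p).nonneg ω) (ind_nonneg _)
  · have h' : μ⟦p, P⟧ * (μ⟦p, A⟧ * μ⟦p, W ∩ P⟧) ≤ μ⟦p, P⟧ * μ⟦p, A ∩ W ∩ P⟧ := by
      calc μ⟦p, P⟧ * (μ⟦p, A⟧ * μ⟦p, W ∩ P⟧) = μ⟦p, A⟧ * μ⟦p, P⟧ * μ⟦p, W ∩ P⟧ := by ring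
        _ ≤ μ⟦p, P⟧ * μ⟦p, A ∩ W ∩ P⟧ := hcond
    exact le_of_mul_le_mul_left h' hP

/-- **HARRIS FIBRE BY FIBRE.**  If `A` is increasing and determined by `S`, `W` is increasing, and `C` is ANY event
determined by a coordinate set `T` disjoint from `S`, then `μ⟦A⟧·μ⟦W ∩ C⟧ ≤ μ⟦A ∩ W ∩ C⟧` under every product
weight. [this work] -/
theorem fibreHarris_of_determinedBy (p : ι → unitInterval) {A W C : Set (Set ι)} (hA : IsUpperSet A)
    (hW : IsUpperSet W) {S T : Finset ι} (hST : Disjoint S T) (hAS : DeterminedBy A (↑S : Set ι))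
    (hCT : DeterminedBy C (↑T : Set ι)) :
    μ⟦p, A⟧ * μ⟦p, W ∩ C⟧ ≤ μ⟦p, A ∩ W ∩ C⟧ := by
  rw [ex_ind_inter_eq_sum_atoms p hCT W, ex_ind_inter_eq_sum_atoms p hCT (A ∩ W), Finset.mul_sum]
  exact Finset.sum_le_sum fun τ _ => fibreHarris_atom p hA hW hST hAS τ

end FibrewiseHarris

end Summit.CriticalPhenomena.PercolationContinuityZ3.Theorems
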